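import Summits.ValiantsHypothesis.ValiantsHypothesis.Theorems.DefinabilityGapMergeIsolation
import Summits.ValiantsHypothesis.ValiantsHypothesis.Theorems.DefinabilityGapSupportRung
import HarnessLib

/-!
# DefinabilityGap — CLUSTER MERGING: merges along a list of pairs, and the PATCHED support rung

Route `route-ValiantsHypothesis-DefinabilityGap` (decomp-valiant, lens 5: hardness–randomness / PIT axis); width
road of the read-once leaf F4 / W10 (`KIPlantedHittingRO`, stmt-ValiantsHypothesis-23704, aside), on top of
`DefinabilityGapBlockMerging` (`kiWord`, `wordCell`, `wordPoly`, `patch`, `mergeSub`, `rename_mergeSub_bind₁`,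
`agree`, `differ`, `card_agree_kiWord_le`, `dprod`, `bind₁_dprod`), `DefinabilityGapMergeIsolation` (the generic
defect calculus `card_differ_patch_le`, `wordPoly_ne_of_differ_le`) and the GENERIC Kabanets–Impagliazzo design
argument of `DefinabilityGapSupportRung` (`KIPrivate.bind₁_kiGenerator_perPoly_ne_zero`). `φ = bind₁ (kiPer m)`,
`P_c = kiPer m c = wordPoly (kiWord c)`.
ELEMENTARY · INSTRUMENT (y-side: the seed-side merge lever of `DefinabilityGapBlockMerging` /
`DefinabilityGapMergeIsolation` iterated along an arbitrary LIST of pairs, plus the support rung re-proved for the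
resulting bounded-defect word families — the refactor `kiPer ↦ wordPoly ∘ W`; the engine of
`DefinabilityGapMatchingSums`, whose z-side gap-scale clustering is the NEW part) · 0 S-currency · closes NO item ·
graphical forms z_a − z_b only; non-matching multisets, general affine forms and the leaf regime w = q^b ≫ m NOT
claimed · K1 / stmt-23704 / VP ≠ VNP untouched.

## Merging along a list (§1)

For a list `L = [p_r, …, p_1]` of pairs `p_i = (a_i, b_i)` of blocks, `wordL L` is the word family obtained from the
curve words `kiWord` by merging `b_1 → a_1`, then `b_2 → a_2` on the patched family, … (head of the list = last
merge): `wordL (p :: L) c = patch (wordL L p.1) (wordL L p.2) (wordL L c)`, and `φ_L := bind₁ (wordPoly ∘ wordL L)`.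
KILL: every pair of `L` is identified, `wordL L b_i = wordL L a_i` (identifications persist under later patches,
`wordL_snd_eq`), so `φ_L Δ_N = 0` whenever some `p_i ∈ N` (`bind₁_wordL_dprod_eq_zero`); and `φ_L = ρ ∘ φ` for a
composite `ρ` of the renamings `mergeSub` (`exists_algHom_wordL`), so `φ D = 0 ⟹ φ_L D = 0`
(`bind₁_wordL_eq_zero_of_kiPer`). SURVIVE: when the pairs are loopless and pairwise vertex-disjoint, a live label
(`c ∉ {b_i}`) has DEFECT `|differ (wordL L c) (kiWord c)| ≤ 3^r − 1` (`card_differ_wordL_lt`, the defect calculus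
iterated), representatives `repL` (`b_i ↦ a_i`) satisfy `wordL L u = wordL L (repL L u)` and separate the endpoints of
every loopless edge other than the pairs and their reverses (`repL_ne`), hence `φ_L Δ_E ≠ 0` for every loopless edge
set `E` avoiding the pairs once `2·3^r < m²` (`bind₁_wordL_dprod_ne_zero`).

## The patched support rung (§2, `bind₁_wordL_ne_zero`)

The cells `{(p, wordL L c p)}` of two distinct live labels meet in `≤ |agree| ≤ 2·3^r − 2` points
(`card_cells_inter_le`, `card_agree_wordL_le`), so on any set `T` of live labels the cell embeddings form an NW
design with parameter `2·3^r`, `wordPoly (wordL L c)` IS the Kabanets–Impagliazzo generator of `per_m` on that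
design, and the tree's generic `KIPrivate.bind₁_kiGenerator_perPoly_ne_zero` gives: every nonzero `h` with
`vars h ⊆ T` and `2·3^r·(|T| − 1) < m²` has `φ_L h ≠ 0`. At `L = []` this is `kiPer_hits_support` again.

## Where this sits (HONEST BOUNDARY)

Pure instrument: no statement about sums of products is made here; `DefinabilityGapMatchingSums` combines §1–§2 with
the gap-scale clustering of matching families. General graphical MULTISETS, affine forms and the leaf regime
w = q^b ≫ m are NOT claimed; K1 / stmt-23704 / VP ≠ VNP untouched.
-/

noncomputable section

open MvPolynomial
open Literature.Computability.AlgebraicComplexity Literature.Computability.MetaComplexity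
open Summit.ValiantsHypothesis.ValiantsHypothesis.Theorems.DefinabilityGapAffineRung
open Summit.ValiantsHypothesis.ValiantsHypothesis.Theorems.DefinabilityGapBlockMerging
open Summit.ValiantsHypothesis.ValiantsHypothesis.Theorems.DefinabilityGapMergeIsolation
open Summit.ValiantsHypothesis.ValiantsHypothesis.Theorems.DefinabilityGapSupportRung

set_option linter.dupNamespace false

namespace Summit.ValiantsHypothesis.ValiantsHypothesis.Theorems.DefinabilityGapClusterMerging

variable {m : ℕ}

/-! ## 1. Merging along a list of pairs -/

/-- The word family after merging along the list `L` (head = last merge): `wordL [] = kiWord`,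
`wordL (p :: L) c = patch (wordL L p.1) (wordL L p.2) (wordL L c)`. [this file] -/
def wordL (m : ℕ) : List ((Fin 3 → Fin (qOf m)) × (Fin 3 → Fin (qOf m))) →
    (Fin 3 → Fin (qOf m)) → Fin (qOf m) → Fin (qOf m)
  | [] => kiWord m
  | p :: L => fun c => patch (wordL m L p.1) (wordL m L p.2) (wordL m L c)

/-- The representative of a block after the merges of `L` (`b_i ↦ a_i`, identity on live labels). [this file] -/
def repL : List ((Fin 3 → Fin (qOf m)) × (Fin 3 → Fin (qOf m))) → (Fin 3 → Fin (qOf m)) → (Fin 3 → Fin (qOf m))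
  | [] => fun u => u
  | p :: L => fun u => if u = p.2 then p.1 else repL L u

/-- No merge: the curve words. [this file] -/
theorem wordL_nil : wordL m [] = kiWord m := rfl

/-- One more merge on top of the family of `L`. [this file] -/
theorem wordL_cons (p : (Fin 3 → Fin (qOf m)) × (Fin 3 → Fin (qOf m)))
    (L : List ((Fin 3 → Fin (qOf m)) × (Fin 3 → Fin (qOf m)))) (c : Fin 3 → Fin (qOf m)) :
    wordL m (p :: L) c = patch (wordL m L p.1) (wordL m L p.2) (wordL m L c) := rfl

/-- KILL: every merged pair stays identified under all later patches. [this file] -/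
theorem wordL_snd_eq {L : List ((Fin 3 → Fin (qOf m)) × (Fin 3 → Fin (qOf m)))}
    {p : (Fin 3 → Fin (qOf m)) × (Fin 3 → Fin (qOf m))} (hp : p ∈ L) : wordL m L p.2 = wordL m L p.1 := by
  induction L with
  | nil => exact absurd hp List.not_mem_nil
  | cons p' L ih =>
    rw [wordL_cons, wordL_cons]
    rcases List.mem_cons.1 hp with rfl | h
    · rw [patch_apply_self, patch_apply_left]
    · rw [ih h]

/-- `φ_L Δ_N = 0` as soon as a merged pair is an edge of `N`. [this file] -/
theorem bind₁_wordL_dprod_eq_zero {L : List ((Fin 3 → Fin (qOf m)) × (Fin 3 → Fin (qOf m)))}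
    {p : (Fin 3 → Fin (qOf m)) × (Fin 3 → Fin (qOf m))} (hp : p ∈ L)
    {N : Finset ((Fin 3 → Fin (qOf m)) × (Fin 3 → Fin (qOf m)))} (hN : p ∈ N) :
    bind₁ (fun c => wordPoly m (wordL m L c)) (dprod N) = 0 := by
  rw [bind₁_dprod]
  refine Finset.prod_eq_zero hN ?_
  show wordPoly m (wordL m L p.1) - wordPoly m (wordL m L p.2) = 0
  rw [wordL_snd_eq hp, sub_self]

/-- Merging commutes with substitution, one more step: `rename σ_p ∘ φ_L = φ_{p :: L}`. [this file] -/
theorem rename_mergeSub_bind₁_wordL (L : List ((Fin 3 → Fin (qOf m)) × (Fin 3 → Fin (qOf m))))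
    (p : (Fin 3 → Fin (qOf m)) × (Fin 3 → Fin (qOf m))) (D : MvPolynomial (Fin 3 → Fin (qOf m)) ℂ) :
    rename (mergeSub m (wordL m L p.1) (wordL m L p.2)) (bind₁ (fun c => wordPoly m (wordL m L c)) D) =
      bind₁ (fun c => wordPoly m (wordL m (p :: L) c)) D := by
  exact rename_mergeSub_bind₁ (wordL m L) _ _ D

/-- `φ_L = ρ ∘ φ` for an algebra endomorphism `ρ` of `ℂ[y]` (the composite of the renamings). [this file] -/
theorem exists_algHom_wordL (L : List ((Fin 3 → Fin (qOf m)) × (Fin 3 → Fin (qOf m)))) :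
    ∃ ρ : MvPolynomial (Fin (qOf m) × Fin (qOf m)) ℂ →ₐ[ℂ] MvPolynomial (Fin (qOf m) × Fin (qOf m)) ℂ,
      ∀ D : MvPolynomial (Fin 3 → Fin (qOf m)) ℂ,
        ρ (bind₁ (kiPer m) D) = bind₁ (fun c => wordPoly m (wordL m L c)) D := by
  induction L with
  | nil =>
    refine ⟨AlgHom.id ℂ _, fun D => ?_⟩
    rw [AlgHom.id_apply]
    exact congrArg (fun P : (Fin 3 → Fin (qOf m)) → MvPolynomial (Fin (qOf m) × Fin (qOf m)) ℂ => bind₁ P D)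
      (funext fun c => kiPer_eq_wordPoly c)
  | cons p L ih =>
    obtain ⟨ρ, hρ⟩ := ih
    refine ⟨(rename (mergeSub m (wordL m L p.1) (wordL m L p.2))).comp ρ, fun D => ?_⟩
    rw [AlgHom.comp_apply, hρ, rename_mergeSub_bind₁_wordL]

/-- `φ D = 0 ⟹ φ_L D = 0`. [this file] -/
theorem bind₁_wordL_eq_zero_of_kiPer (L : List ((Fin 3 → Fin (qOf m)) × (Fin 3 → Fin (qOf m))))
    {D : MvPolynomial (Fin 3 → Fin (qOf m)) ℂ} (h0 : bind₁ (kiPer m) D = 0) :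
    bind₁ (fun c => wordPoly m (wordL m L c)) D = 0 := by
  obtain ⟨ρ, hρ⟩ := exists_algHom_wordL (m := m) L
  rw [← hρ, h0, map_zero]

/-! ## 2. Defects, representatives, survival -/

/-- DEFECT BOUND: along `r` merges with pairwise distinct merged-away labels `b_i`, a live label (`c ∉ {b_i}`) has
defect `≤ 3^r − 1` (`card_differ_patch_le` iterated). [this file] -/
theorem card_differ_wordL_lt {L : List ((Fin 3 → Fin (qOf m)) × (Fin 3 → Fin (qOf m)))}
    (hB : L.Pairwise fun p p' => p.2 ≠ p'.2) {c : Fin 3 → Fin (qOf m)} (hc : ∀ p ∈ L, c ≠ p.2) :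
    (differ (wordL m L c) (kiWord m c)).card < 3 ^ L.length := by
  induction L generalizing c with
  | nil =>
    rw [wordL_nil, List.length_nil, pow_zero, Nat.lt_one_iff, Finset.card_eq_zero]
    exact Finset.eq_empty_of_forall_notMem fun k hk => (mem_differ.1 hk) rfl
  | cons p L ih =>
    rw [wordL_cons, List.length_cons, pow_succ]
    obtain ⟨hB₁, hB₂⟩ := List.pairwise_cons.1 hB
    have h1 := ih hB₂ fun p' hp' => hc p' (List.mem_cons_of_mem _ hp')
    have h2 := ih hB₂ (c := p.2) fun p' hp' => hB₁ p' hp'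
    have h3 := card_differ_patch_le (W := wordL m L) (a := p.1) (hc p List.mem_cons_self)
      (Nat.le_sub_one_of_lt h1) (Nat.le_sub_one_of_lt h2)
    omega

/-- Every block carries the word of its representative. [this file] -/
theorem wordL_repL (L : List ((Fin 3 → Fin (qOf m)) × (Fin 3 → Fin (qOf m)))) (u : Fin 3 → Fin (qOf m)) :
    wordL m L u = wordL m L (repL L u) := by
  induction L with
  | nil => rfl
  | cons p L ih =>
    show patch (wordL m L p.1) (wordL m L p.2) (wordL m L u) =
      patch (wordL m L p.1) (wordL m L p.2) (wordL m L (if u = p.2 then p.1 else repL L u))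
    by_cases h : u = p.2
    · rw [if_pos h, h, patch_apply_self, patch_apply_left]
    · rw [if_neg h, ← ih]

/-- The two cases of the representative map. [this file] -/
theorem repL_spec (L : List ((Fin 3 → Fin (qOf m)) × (Fin 3 → Fin (qOf m)))) (u : Fin 3 → Fin (qOf m)) :
    (repL L u = u ∧ ∀ p ∈ L, u ≠ p.2) ∨ ∃ p ∈ L, u = p.2 ∧ repL L u = p.1 := by
  induction L with
  | nil => exact Or.inl ⟨rfl, fun p hp => absurd hp List.not_mem_nil⟩
  | cons p L ih =>
    have hrep : repL (p :: L) u = if u = p.2 then p.1 else repL L u := rfl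
    rw [hrep]
    by_cases h : u = p.2
    · exact Or.inr ⟨p, List.mem_cons_self, h, if_pos h⟩
    · rcases ih with ⟨hr, hn⟩ | ⟨p', hp', hu, hr⟩
      · refine Or.inl ⟨(if_neg h).trans hr, fun p' hp' => ?_⟩
        rcases List.mem_cons.1 hp' with rfl | hp'
        · exact h
        · exact hn p' hp'
      · exact Or.inr ⟨p', List.mem_cons_of_mem _ hp', hu, (if_neg h).trans hr⟩

/-- Representatives are live labels when no `a_i` is a `b_j`. [this file] -/
theorem repL_live {L : List ((Fin 3 → Fin (qOf m)) × (Fin 3 → Fin (qOf m)))}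
    (hA : ∀ p ∈ L, ∀ p' ∈ L, p.1 ≠ p'.2) (u : Fin 3 → Fin (qOf m)) : ∀ p ∈ L, repL L u ≠ p.2 := by
  intro p hp
  rcases repL_spec L u with ⟨hr, hn⟩ | ⟨p', hp', -, hr⟩
  · rw [hr]; exact hn p hp
  · rw [hr]; exact hA p' hp' p hp

/-- Distinct representatives: a loopless edge other than the pairs (and their reverses) keeps distinct endpoints after
the merges, when the pairs are pairwise vertex-disjoint. [this file] -/
theorem repL_ne {L : List ((Fin 3 → Fin (qOf m)) × (Fin 3 → Fin (qOf m)))}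
    (hV : ∀ p ∈ L, ∀ p' ∈ L, p ≠ p' → p.1 ≠ p'.1 ∧ p.1 ≠ p'.2 ∧ p.2 ≠ p'.1 ∧ p.2 ≠ p'.2)
    {e : (Fin 3 → Fin (qOf m)) × (Fin 3 → Fin (qOf m))} (hl : e.1 ≠ e.2)
    (he : ∀ p ∈ L, e ≠ p ∧ e ≠ (p.2, p.1)) : repL L e.1 ≠ repL L e.2 := by
  rcases repL_spec L e.1 with ⟨ru, hu⟩ | ⟨p, hp, hu, ru⟩ <;>
    rcases repL_spec L e.2 with ⟨rv, hv⟩ | ⟨p', hp', hv, rv⟩ <;> rw [ru, rv]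
  · exact hl
  · exact fun h => (he p' hp').1 (Prod.ext h hv)
  · exact fun h => (he p hp).2 (Prod.ext hu h.symm)
  · intro h
    by_cases hpp : p = p'
    · subst hpp; exact hl (hu.trans hv.symm)
    · exact (hV p hp p' hp' hpp).1 h

/-- SURVIVE, one factor: distinct patched block polynomials at the endpoints of a loopless edge avoiding the pairs,
once `2·3^r < m²`. [this file] -/
theorem wordPoly_wordL_ne {L : List ((Fin 3 → Fin (qOf m)) × (Fin 3 → Fin (qOf m)))} (hN : L.Nodup)
    (hV : ∀ p ∈ L, ∀ p' ∈ L, p ≠ p' → p.1 ≠ p'.1 ∧ p.1 ≠ p'.2 ∧ p.2 ≠ p'.1 ∧ p.2 ≠ p'.2)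
    (hl : ∀ p ∈ L, p.1 ≠ p.2) (hmL : 2 * 3 ^ L.length < m * m)
    {e : (Fin 3 → Fin (qOf m)) × (Fin 3 → Fin (qOf m))} (hle : e.1 ≠ e.2)
    (he : ∀ p ∈ L, e ≠ p ∧ e ≠ (p.2, p.1)) : wordPoly m (wordL m L e.1) ≠ wordPoly m (wordL m L e.2) := by
  have hB : L.Pairwise fun p p' => p.2 ≠ p'.2 :=
    hN.pairwise_of_forall_ne fun p hp p' hp' hpp => (hV p hp p' hp' hpp).2.2.2
  have hA : ∀ p ∈ L, ∀ p' ∈ L, p.1 ≠ p'.2 := fun p hp p' hp' => by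
    by_cases hpp : p = p'
    · subst hpp; exact hl p hp
    · exact (hV p hp p' hp' hpp).2.1
  have hx : 1 ≤ 3 ^ L.length := Nat.one_le_pow _ _ (by norm_num)
  rw [wordL_repL L e.1, wordL_repL L e.2]
  exact wordPoly_ne_of_differ_le (D := 3 ^ L.length - 1) (by omega) (repL_ne hV hle he)
    (Nat.le_sub_one_of_lt (card_differ_wordL_lt hB (repL_live hA e.1)))
    (Nat.le_sub_one_of_lt (card_differ_wordL_lt hB (repL_live hA e.2)))

/-- SURVIVE: `φ_L Δ_E ≠ 0` for every loopless edge set `E` avoiding the pairs (both orientations). [this file] -/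
theorem bind₁_wordL_dprod_ne_zero {L : List ((Fin 3 → Fin (qOf m)) × (Fin 3 → Fin (qOf m)))} (hN : L.Nodup)
    (hV : ∀ p ∈ L, ∀ p' ∈ L, p ≠ p' → p.1 ≠ p'.1 ∧ p.1 ≠ p'.2 ∧ p.2 ≠ p'.1 ∧ p.2 ≠ p'.2)
    (hl : ∀ p ∈ L, p.1 ≠ p.2) (hmL : 2 * 3 ^ L.length < m * m)
    {E : Finset ((Fin 3 → Fin (qOf m)) × (Fin 3 → Fin (qOf m)))}
    (hE : ∀ e ∈ E, e.1 ≠ e.2 ∧ ∀ p ∈ L, e ≠ p ∧ e ≠ (p.2, p.1)) :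
    bind₁ (fun c => wordPoly m (wordL m L c)) (dprod E) ≠ 0 := by
  rw [bind₁_dprod, Finset.prod_ne_zero_iff]
  intro e heE
  obtain ⟨hle, he⟩ := hE e heE
  exact sub_ne_zero.2 (wordPoly_wordL_ne hN hV hl hmL hle he)

/-! ## 3. The patched support rung -/

/-- The cells of two words meet in at most `|agree|` points. [this file] -/
theorem card_cells_inter_le (w w' : Fin (qOf m) → Fin (qOf m)) :
    (Finset.univ.map ⟨wordCell m w, wordCell_injective w⟩ ∩
        Finset.univ.map ⟨wordCell m w', wordCell_injective w'⟩).card ≤ (agree w w').card := by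
  refine Finset.card_le_card_of_injOn Prod.fst (fun x hx => ?_) fun x hx y hy hxy => ?_
  · obtain ⟨hx₁, hx₂⟩ := Finset.mem_inter.1 (Finset.mem_coe.1 hx)
    obtain ⟨jk, -, rfl⟩ := Finset.mem_map.1 hx₁
    obtain ⟨jk', -, hjk'⟩ := Finset.mem_map.1 hx₂
    have h₂ : wordCell m w' jk' = wordCell m w jk := hjk'
    have hp : permPad (sq_le_qOf m) jk' = permPad (sq_le_qOf m) jk := (Prod.ext_iff.1 h₂).1
    have hv : w' (permPad (sq_le_qOf m) jk') = w (permPad (sq_le_qOf m) jk) := (Prod.ext_iff.1 h₂).2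
    rw [hp] at hv
    exact Finset.mem_coe.2 (mem_agree.2 hv.symm)
  · obtain ⟨jk, -, rfl⟩ := Finset.mem_map.1 (Finset.mem_inter.1 (Finset.mem_coe.1 hx)).1
    obtain ⟨jk₂, -, rfl⟩ := Finset.mem_map.1 (Finset.mem_inter.1 (Finset.mem_coe.1 hy)).1
    have h₃ : permPad (sq_le_qOf m) jk = permPad (sq_le_qOf m) jk₂ := hxy
    rw [(permPad (sq_le_qOf m)).injective h₃]

/-- Two distinct live labels agree on `≤ 2 + 2·(3^r − 1) = 2·3^r` positions. [this file] -/
theorem card_agree_wordL_le {L : List ((Fin 3 → Fin (qOf m)) × (Fin 3 → Fin (qOf m)))}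
    (hB : L.Pairwise fun p p' => p.2 ≠ p'.2) {c c' : Fin 3 → Fin (qOf m)} (hcc' : c ≠ c')
    (hc : ∀ p ∈ L, c ≠ p.2) (hc' : ∀ p ∈ L, c' ≠ p.2) :
    (agree (wordL m L c) (wordL m L c')).card ≤ 2 * 3 ^ L.length := by
  have h1 := Finset.card_le_card (agree_subset (wordL m L c) (kiWord m c) (wordL m L c') (kiWord m c'))
  have h2 := Finset.card_union_le (agree (kiWord m c) (kiWord m c') ∪ differ (wordL m L c) (kiWord m c))
    (differ (wordL m L c') (kiWord m c'))
  have h3 := Finset.card_union_le (agree (kiWord m c) (kiWord m c')) (differ (wordL m L c) (kiWord m c))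
  have h4 := card_agree_kiWord_le (m := m) hcc'
  have h5 := card_differ_wordL_lt hB hc
  have h6 := card_differ_wordL_lt hB hc'
  omega

/-- ★ **THE PATCHED SUPPORT RUNG**: after loopless, pairwise vertex-disjoint merges `L` (`r = |L|`), every nonzero
`h` whose variables lie in a set `T` of LIVE labels with `2·3^r·(|T| − 1) < m²` survives: `φ_L h ≠ 0` — the cell
embeddings of `T` form an NW design with parameter `2·3^r` and `KIPrivate.bind₁_kiGenerator_perPoly_ne_zero` applies.
[this file] -/
theorem bind₁_wordL_ne_zero {L : List ((Fin 3 → Fin (qOf m)) × (Fin 3 → Fin (qOf m)))} (hN : L.Nodup)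
    (hV : ∀ p ∈ L, ∀ p' ∈ L, p ≠ p' → p.1 ≠ p'.1 ∧ p.1 ≠ p'.2 ∧ p.2 ≠ p'.1 ∧ p.2 ≠ p'.2)
    (T : Finset (Fin 3 → Fin (qOf m))) (hT : ∀ c ∈ T, ∀ p ∈ L, c ≠ p.2)
    (hmT : 2 * 3 ^ L.length * (T.card - 1) < m * m) {h : MvPolynomial (Fin 3 → Fin (qOf m)) ℂ} (hh : h ≠ 0)
    (hvars : h.vars ⊆ T) : bind₁ (fun c => wordPoly m (wordL m L c)) h ≠ 0 := by
  have hB : L.Pairwise fun p p' => p.2 ≠ p'.2 :=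
    hN.pairwise_of_forall_ne fun p hp p' hp' hpp => (hV p hp p' hp' hpp).2.2.2
  have hdes : IsNWDesign (2 * 3 ^ L.length) (fun c : ↥T =>
      (⟨wordCell m (wordL m L c), wordCell_injective (wordL m L c)⟩ :
        Fin m × Fin m ↪ Fin (qOf m) × Fin (qOf m))) := by
    intro c c' hcc'
    have hne : (c : Fin 3 → Fin (qOf m)) ≠ c' := fun e => hcc' (Subtype.ext e)
    exact (card_cells_inter_le (m := m) (wordL m L c) (wordL m L c')).trans
      (card_agree_wordL_le hB hne (hT _ c.2) (hT _ c'.2))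
  obtain ⟨h₀, hh₀⟩ := exists_rename_eq_of_vars_subset_range h ((↑) : ↥T → Fin 3 → Fin (qOf m))
    Subtype.val_injective fun x hx => ⟨⟨x, hvars (Finset.mem_coe.1 hx)⟩, rfl⟩
  have hh₀0 : h₀ ≠ 0 := by
    rintro rfl
    exact hh (by rw [← hh₀, map_zero])
  have hcard : h₀.vars.card ≤ T.card := (Finset.card_le_univ _).trans (Fintype.card_coe T).le
  have hvars₀ : 2 * 3 ^ L.length * (h₀.vars.card - 1) < m * m :=
    lt_of_le_of_lt (Nat.mul_le_mul_left _ (Nat.sub_le_sub_right hcard 1)) hmT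
  have key : bind₁ ((fun c => wordPoly m (wordL m L c)) ∘ ((↑) : ↥T → Fin 3 → Fin (qOf m))) h₀ ≠ 0 := by
    have hfun : ((fun c => wordPoly m (wordL m L c)) ∘ ((↑) : ↥T → Fin 3 → Fin (qOf m))) =
        kiGenerator (perPoly (Fin m) ℂ) (fun c : ↥T =>
          (⟨wordCell m (wordL m L c), wordCell_injective (wordL m L c)⟩ :
            Fin m × Fin m ↪ Fin (qOf m) × Fin (qOf m))) :=
      funext fun c => rfl
    rw [hfun]
    exact KIPrivate.bind₁_kiGenerator_perPoly_ne_zero (F := ℂ) hdes hh₀0 hvars₀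
  rw [← hh₀, bind₁_rename]
  exact key

end Summit.ValiantsHypothesis.ValiantsHypothesis.Theorems.DefinabilityGapClusterMerging

end
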